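import Literature.MathematicalPhysics.QuantumFieldTheory.Balaban1983to89.B9Eq3126H1kLipschitzEnergyClosed
import Literature.MathematicalPhysics.QuantumFieldTheory.Balaban1983to89.B9Eq325RLipschitzSqrtTowerPackaged

/-!
# `Balaban1983to89.B9Eq3126H1kLipschitzEnergyLetterfree` — T. Bałaban, *Propagators for lattice gauge theories in a background field*, Commun. Math. Phys.
# **99** (1985) 389–434 [Balaban1985BackgroundPropagators] (3.126) p. 420 *«HB = GQ*(QGQ*)⁻¹B»* with Thm 3.4 p. 400, (3.25) p. 394, (3.84)–(3.86) p. 407,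
# Thm 3.11 p. 416 AT `k = n+1` AVERAGING LEVELS ON PRINT's DIAGONAL `ηL^{n+1} = 1`, and [Balaban1985Variational] (45)–(46) p. 285: **`H_{1,k}(U) − H_{1,k}(1) = O(α)`
# IN THE FLAT ENERGY NORM WITH NO DISPLAYED OPERATOR LETTER AT ALL — `∃ α₀ C > 0` CLOSED IN `(d, a, L, M_φ, M_φ′, r, C_τ, ρ_w)`** (this lineage's
# `B9Eq3126H1kLipschitzEnergyClosed` with its last letter, the `R`-letter `C_R`, inhabited by NE9 leaf-03's `B9Eq325RLipschitzSqrtTowerPackaged`; the `H`-mirror of NE9 leaf-04's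
# `B9Eq386GreenLipschitzEnergyClosed.exists_norm_G1k_sub_flat_le_diagonal_letterfree`)

statement-level skeleton of published theorems with citation tags; proofs where landed; nothing here is a claim about the Yang–Mills mass gap

CITATION HEADER (lean-in-tree rule).  Audit cell `pub-balaban`, sub-cell `t4`, BINDER row NE9; filed by NE9 formalisation-swarm LEAF PROVER 02
(`b2b-balaban-t4-ne9-formalise-leaf-02`, gen 66) on the row OWNER `b2b-balaban-t4-ne9-p1`'s energy-currency chain (g86 ENERGY-PROGRAMME §3 (d): «`𝔊_k(U) − 𝔊_k(1)`,
`H_{1,k}(U) − H_{1,k}(1)` in the energy norm»).  Sources READ first-hand in the held text layer [Balaban1985BackgroundPropagators]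
(`paper:balaban1985-cmp99-background-propagators`, journal page = PDF page + 388) pp. 394, 400, 403, 406–407, 416, 420; [Balaban1985Variational] p. 285 via the tree's
quotations (the host files).
THE PRINT (verbatim): [B9] p. 420 *«HB = GQ*(QGQ*)⁻¹B»*; p. 400, Thm 3.4: *«… describing these analytic extensions as small perturbations of the operators
depending on U only.»*; [B11] p. 285 *«… |HB| ≤ B₀(L^jη)^{−1}|B|»* with `B₀` uniform in the lattice and in `j`.

WHY THIS FILE (cell context).  `B9Eq3126H1kLipschitzEnergyClosed.exists_norm_H1k_sub_flat_le_closed` (this lineage, on the OWNER's host) displays ONE operator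
letter, `hR : ‖R_k(U)s − R_k(1)s‖ ≤ C_R·α·‖s‖`; `B9Eq325RLipschitzSqrtTowerPackaged.exists_norm_RofUk_sub_RofUk_one_le_diagonal` (NE9 leaf-03 g66, packaging
leaf-04's `norm_RofUk_sub_RofUk_one_le_diagonal_linear`; the package of record by the row OWNER's ruling) produces it with `C_R` closed in `(d, L, M_φM_φ′, r)` under the SAME windows; the level memberships
`Ū^j(b) ∈ U1` come from the tower datum `hU1` (`B9Thm311SmallFieldCoercivityTowerClosed.hLb_of_hU1`), `hRS` from unitarity + the trace letters
(`B9Eq310HessianHermitian.adTransportW_adjoint`).  So the `H_{1,k}`-Lipschitz letter of the chart (`Support/NE9CurChartLipschitzAtFlat`'s shape, first order at the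
flat point) holds with NO displayed operator letter: the remaining hypotheses are E162's per-level data, unitarity, the small-field WINDOWS, the trace letters, `ρ_w`,
`1 ≤ d`, `3 ≤ L^{n+1}`, and ANY positivity ∕ onto witnesses (theorems on the diagonal: `B9Thm311LaplaceAkPositiveDiagonal`, `QkW_surjective`).

WHAT IS PROVED (sorry-free; 0 `def`; [folklore] composition BY NAME of two landed `∃`-theorems + `min` of two ceilings; nothing of [B9]∕[B11] asserted as printed).
* **`exists_norm_H1k_sub_flat_le_letterfree`** — `B9Eq3126H1kLipschitzEnergyClosed.exists_norm_H1k_sub_flat_le_closed` WITH THE `C_R`∕`hR` BINDERS REMOVED: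
  `∃ α₀ C > 0` (closed in `(d, a, L, M_φ, M_φ′, r, C_τ, ρ_w)`) such that for every `n` (`3 ≤ L^{n+1}`), `η` (`ηL^{n+1} = 1`), `c₀, c₁` (`c₀(L^{n+1})^d = c₁`,
  `|η|^d∕c₀ ≤ ρ_w`), `m`, background `U` of E162's data, unitary, `U(b) ∈ U1`, in the windows `‖U(b) − 1‖ ≤ αη`, `‖U(∂p) − 1‖ ≤ αη²`, `‖Ū^j(b) − 1‖ ≤ ε_j ≤ αr^j`
  with `0 ≤ α ≤ α₀`, ANY `hposU`, `hpos1`, `hQU`, `hQ1`, and every block field `b`: `‖H_k(U)b − H_k(1)b‖ ≤ Cα‖b‖ ∧ ‖curl₁(…)‖ ≤ Cα‖b‖ ∧ ‖div₁(…)‖ ≤ Cα‖b‖`.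
HONEST SCOPE.  FIRST order at the flat point on the diagonal ONLY; the `L²`∕energy clause — no kernel bound, no decay, NOT [B9] Thm 3.12, NOT the (N)-reading; crude
constants; the windows, unitarity, the trace letters, `ρ_w` and the witnesses stay HYPOTHESES.  NOT summit progress (cell pub-balaban: NE9 NOT PRINTED ∕ NOT PROVED;
«NE9 ⇐ the named binders»; row WALLED ON A MODEL (O-NE9-1; #5 UNRULED); spine PROVED 0∕9; rung (B)+1 finite T⁴ — NOT infinite volume, NOT mass gap, NOT BetaPertH,
NOT Clay).  HONEST DEPENDENCY (cell line): continuum YM on T⁴ ⇐ BetaPertH ∧ nine spine estimates (0/9 proved); BetaPertH ⇐ (D1) ∧ (D4) ∧ CAP+tail; G-an2-4 gates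
asym, D1 and NE2/3/4.  NEW file importing `B9Eq3126H1kLipschitzEnergyClosed` (this lineage) and `B9Eq325RLipschitzSqrtTowerPackaged` (leaf-03); nothing modified.  Net new
unproved facts: 0.
-/

noncomputable section

open scoped InnerProductSpace ComplexConjugate BigOperators

namespace Literature.MathematicalPhysics.QuantumFieldTheory.Balaban1983to89.B9Eq3126H1kLipschitzEnergyLetterfree

open B4Sect5Torus (TSite)
open B9SectCLatticeCarrier (Bond)
open B11Eq103H1Complex (SiteL2K BondL2K covDivL2K H1LatticeK)
open B9Eq310HessianOperator (adTransportW hessOp covCurlL2K)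
open B9Eq310HessianHermitian (adTransportW_adjoint)
open B9Eq310DeltaPrime (plaqHolU)
open B9Eq315QTorus (perCfg cornerSite)
open B9Eq315QTower (towerP UlevOf)
open B9Eq315QTowerFlat (perCfg_UlevOf_one_mem_U1 norm_Wcx_UlevOf_one_sub_one_le)
open B9Eq326OperatorTower (laplaceAk QkW RofUk)
open B7Prop1Explicit (U1 Wcx boxVec)
open B9Thm311SmallFieldCoercivityTowerClosed (hLb_of_hU1)
open B9Eq325RLipschitzSqrtTowerPackaged (exists_norm_RofUk_sub_RofUk_one_le_diagonal)
open B9Eq3126H1kLipschitzEnergyClosed (exists_norm_H1k_sub_flat_le_closed)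

variable {d : ℕ} (hd : 1 ≤ d) (L : ℕ) [NeZero L] (hL : 1 ≤ L)
  {𝔸 : Type*} [NormedRing 𝔸] [NormedAlgebra ℂ 𝔸] [CompleteSpace 𝔸] [NormOneClass 𝔸] [StarRing 𝔸] [NormedStarGroup 𝔸] [StarModule ℂ 𝔸]
  {W : Type*} [NormedAddCommGroup W] [InnerProductSpace ℂ W] [FiniteDimensional ℂ W] (φ : W ≃ₗ[ℂ] 𝔸)
  {Mφ Mφ' : ℝ} (hMφ : 0 ≤ Mφ) (hMφ' : 0 ≤ Mφ') (hφ : ∀ w, ‖φ w‖ ≤ Mφ * ‖w‖) (hφ' : ∀ X, ‖φ.symm X‖ ≤ Mφ' * ‖X‖)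
  {a : ℝ} (ha : 0 < a) {r : ℝ} (hr0 : 0 ≤ r) (hr1 : r < 1)
  (τ : 𝔸 →ₗ[ℂ] ℂ) {Cτ : ℝ} (hτ : ∀ X, ‖τ X‖ ≤ Cτ * ‖X‖) (hCτ : 0 ≤ Cτ) {ρw : ℝ} (hρw : 0 ≤ ρw)
  (hτ₁ : ∀ X : 𝔸, τ (star X) = conj (τ X)) (hτ₂ : ∀ X Y : 𝔸, τ (X * Y) = τ (Y * X))
  (hφτ : ∀ X Y : 𝔸, ⟪φ.symm X, φ.symm Y⟫_ℂ = τ (star X * Y))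

include hd hMφ hMφ' hφ hφ' ha hr0 hr1 hτ hCτ hρw hτ₁ hτ₂ hφτ

/-- **`H_{1,k}(U) − H_{1,k}(1) = O(α)` IN THE FLAT ENERGY NORM ON THE DIAGONAL WITH NO DISPLAYED OPERATOR LETTER**: there are `α₀, C > 0` (closed in
`(d, a, L, M_φ, M_φ′, r, C_τ, ρ_w)`) such that for every `n` with `3 ≤ L^{n+1}`, `η` (`ηL^{n+1} = 1`), `c₀, c₁` (`c₀(L^{n+1})^d = c₁`, `|η|^d∕c₀ ≤ ρ_w`), `m`,
background `U` of E162's data which is unitary (`U(b)* = U(b)⁻¹`), `U(b) ∈ U1`, in the windows `‖U(b) − 1‖ ≤ αη`, `‖U(∂p) − 1‖ ≤ αη²`,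
`‖Ū^j(b) − 1‖ ≤ ε_j ≤ αr^j`, `0 ≤ α ≤ α₀`, ANY positivity witnesses `hposU`, `hpos1`, ANY onto-witnesses `hQU`, `hQ1`, and every block field `b`:
`‖H_k(U)b − H_k(1)b‖ ≤ Cα‖b‖`, `‖curl₁(H_k(U)b − H_k(1)b)‖ ≤ Cα‖b‖`, `‖div₁(H_k(U)b − H_k(1)b)‖ ≤ Cα‖b‖` — `exists_norm_H1k_sub_flat_le_closed` at the
`R`-letter constant of `exists_norm_RofUk_sub_RofUk_one_le_diagonal`, whose `hR` is produced inside from the same windows (`hLb_of_hU1` for the level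
memberships, `adTransportW_adjoint` for `hRS`); `α₀` the minimum of the two ceilings. [folklore]
[cite: Balaban1985BackgroundPropagators, (3.126) p.420, Thm 3.4 p.400, (3.25) p.394, p.403, (3.84)–(3.86) p.407, Thm 3.11 p.416, (3.79) p.406; Balaban1985Variational, (45)–(46) p.285] -/
theorem exists_norm_H1k_sub_flat_le_letterfree :
    ∃ α₀ C : ℝ, 0 < α₀ ∧ 0 < C ∧ ∀ (n : ℕ) (η : ℝ), η * (L : ℝ) ^ (n + 1) = 1 → 3 ≤ L ^ (n + 1) →
      ∀ (c₀ c₁ : ℝ) [Fact (0 < c₀)] [Fact (0 < c₁)], c₀ * ((L : ℝ) ^ (n + 1)) ^ d = c₁ → |η| ^ d / c₀ ≤ ρw →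
      ∀ (m : Fin d → ℕ) [∀ i, NeZero (m i)] (U : Bond d (towerP L m (n + 1)) → 𝔸ˣ) (αU : ℕ → ℝ) (hα1 : ∀ j, αU j ≤ 1 / 64)
        (hU1 : ∀ (j : ℕ) (x : B7Prop1Explicit.Site d) (κ : Fin d), perCfg (towerP L m (j + 1)) (UlevOf L m (n + 1) U j) x κ ∈ U1 𝔸)
        (hreg : ∀ (j : ℕ) (y : TSite d (towerP L m j)) (κ : Fin d) (r : Fin d → Fin L),
          ‖((Wcx L (perCfg (towerP L m (j + 1)) (UlevOf L m (n + 1) U j)) (cornerSite L y) κ (boxVec L r) : 𝔸ˣ) : 𝔸) - 1‖ ≤ αU j)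
        (εU : ℕ → ℝ), (∀ j, 0 ≤ εU j) → (∀ (j : ℕ) (b : Bond d (towerP L m (j + 1))), ‖(UlevOf L m (n + 1) U j b : 𝔸) - 1‖ ≤ εU j) →
      ∀ {α : ℝ}, 0 ≤ α → α ≤ α₀ →
        (∀ b, star (U b : 𝔸) = (((U b)⁻¹ : 𝔸ˣ) : 𝔸)) →
        (∀ b, U b ∈ U1 𝔸) → (∀ b, ‖(U b : 𝔸) - 1‖ ≤ α * η) →
        (∀ p : B9SectCLatticeCarrier.Plaq d (towerP L m (n + 1)), ‖(plaqHolU U p : 𝔸) - 1‖ ≤ α * η ^ 2) →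
        (∀ j < n + 1, εU j ≤ α * r ^ j) →
        ∀ (hposU : ∀ x : BondL2K ℂ d (towerP L m (n + 1)) c₀ W, x ≠ 0 →
            0 < RCLike.re ⟪x, laplaceAk L m n φ η U hL αU hα1 hU1 hreg τ (c₀ := c₀) (c₁ := c₁) a x⟫_ℂ)
          (hpos1 : ∀ x : BondL2K ℂ d (towerP L m (n + 1)) c₀ W, x ≠ 0 →
            0 < RCLike.re ⟪x, laplaceAk L m n φ η (fun _ : Bond d (towerP L m (n + 1)) => (1 : 𝔸ˣ)) hL (fun _ => 0) (fun _ => by norm_num)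
              (perCfg_UlevOf_one_mem_U1 L m (n + 1)) (norm_Wcx_UlevOf_one_sub_one_le L m (n + 1) (fun _ => 0) (fun _ => le_rfl)) τ
              (c₀ := c₀) (c₁ := c₁) a x⟫_ℂ)
          (hQU : Function.Surjective (QkW L m n φ U hL αU hα1 hU1 hreg (c₀ := c₀) (c₁ := c₁)))
          (hQ1 : Function.Surjective (QkW L m n φ (fun _ : Bond d (towerP L m (n + 1)) => (1 : 𝔸ˣ)) hL (fun _ => 0) (fun _ => by norm_num)
            (perCfg_UlevOf_one_mem_U1 L m (n + 1)) (norm_Wcx_UlevOf_one_sub_one_le L m (n + 1) (fun _ => 0) (fun _ => le_rfl)) (c₀ := c₀) (c₁ := c₁))),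
        ∀ b : BondL2K ℂ d m c₁ W,
          ‖H1LatticeK hposU hQU b - H1LatticeK (c := ((η : ℂ))⁻¹) (R := adTransportW φ (fun _ : Bond d (towerP L m (n + 1)) => (1 : 𝔸ˣ)))
              (S := adTransportW φ fun _ : Bond d (towerP L m (n + 1)) => (1 : 𝔸ˣ)⁻¹) (Δ₁ := hessOp φ η (fun _ : Bond d (towerP L m (n + 1)) => (1 : 𝔸ˣ)) τ)
              (Rr := RofUk L m n φ η (fun _ : Bond d (towerP L m (n + 1)) => (1 : 𝔸ˣ)))
              (Q := (QkW L m n φ (fun _ : Bond d (towerP L m (n + 1)) => (1 : 𝔸ˣ)) hL (fun _ => 0) (fun _ => by norm_num)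
            (perCfg_UlevOf_one_mem_U1 L m (n + 1)) (norm_Wcx_UlevOf_one_sub_one_le L m (n + 1) (fun _ => 0) (fun _ => le_rfl)) (c₀ := c₀) (c₁ := c₁))) (a := a) hpos1 hQ1 b‖ ≤ C * α * ‖b‖ ∧
          ‖covCurlL2K ℂ c₀ ((η : ℂ))⁻¹ (adTransportW φ (fun _ : Bond d (towerP L m (n + 1)) => (1 : 𝔸ˣ)))
            (H1LatticeK hposU hQU b - H1LatticeK (c := ((η : ℂ))⁻¹) (R := adTransportW φ (fun _ : Bond d (towerP L m (n + 1)) => (1 : 𝔸ˣ)))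
              (S := adTransportW φ fun _ : Bond d (towerP L m (n + 1)) => (1 : 𝔸ˣ)⁻¹) (Δ₁ := hessOp φ η (fun _ : Bond d (towerP L m (n + 1)) => (1 : 𝔸ˣ)) τ)
              (Rr := RofUk L m n φ η (fun _ : Bond d (towerP L m (n + 1)) => (1 : 𝔸ˣ)))
              (Q := (QkW L m n φ (fun _ : Bond d (towerP L m (n + 1)) => (1 : 𝔸ˣ)) hL (fun _ => 0) (fun _ => by norm_num)
            (perCfg_UlevOf_one_mem_U1 L m (n + 1)) (norm_Wcx_UlevOf_one_sub_one_le L m (n + 1) (fun _ => 0) (fun _ => le_rfl)) (c₀ := c₀) (c₁ := c₁))) (a := a) hpos1 hQ1 b)‖ ≤ C * α * ‖b‖ ∧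
          ‖covDivL2K ℂ c₀ ((η : ℂ))⁻¹ (adTransportW φ fun _ : Bond d (towerP L m (n + 1)) => (1 : 𝔸ˣ)⁻¹)
            (H1LatticeK hposU hQU b - H1LatticeK (c := ((η : ℂ))⁻¹) (R := adTransportW φ (fun _ : Bond d (towerP L m (n + 1)) => (1 : 𝔸ˣ)))
              (S := adTransportW φ fun _ : Bond d (towerP L m (n + 1)) => (1 : 𝔸ˣ)⁻¹) (Δ₁ := hessOp φ η (fun _ : Bond d (towerP L m (n + 1)) => (1 : 𝔸ˣ)) τ)
              (Rr := RofUk L m n φ η (fun _ : Bond d (towerP L m (n + 1)) => (1 : 𝔸ˣ)))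
              (Q := (QkW L m n φ (fun _ : Bond d (towerP L m (n + 1)) => (1 : 𝔸ˣ)) hL (fun _ => 0) (fun _ => by norm_num)
            (perCfg_UlevOf_one_mem_U1 L m (n + 1)) (norm_Wcx_UlevOf_one_sub_one_le L m (n + 1) (fun _ => 0) (fun _ => le_rfl)) (c₀ := c₀) (c₁ := c₁))) (a := a) hpos1 hQ1 b)‖ ≤ C * α * ‖b‖ := by
  -- the packaged `R`-letter, closed in `(d, L, M_φM_φ′, r)`
  obtain ⟨αR, CR, hαR, hCR, HR⟩ := exists_norm_RofUk_sub_RofUk_one_le_diagonal (d := d) L φ hMφ hMφ' hφ hφ' hr0 hr1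
  -- the closed host at this `C_R`
  obtain ⟨α₁, C, hα₁, hC, H⟩ :=
    exists_norm_H1k_sub_flat_le_closed hd L hL φ hMφ hMφ' hφ hφ' ha hr0 hr1 τ hτ hCτ hρw hCR.le hτ₁ hτ₂ hφτ
  refine ⟨min αR α₁, C, lt_min hαR hα₁, hC, ?_⟩
  intro n η hηL hL3 c₀ c₁ _ _ hw hρ m _ U αU hα1 hU1 hreg εU hεU hUε α hα0 hαle hUst hUb hUη hpl hεg hposU hpos1 hQU hQ1 b
  have hαR' : α ≤ αR := hαle.trans (min_le_left _ _)
  have hα₁' : α ≤ α₁ := hαle.trans (min_le_right _ _)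
  -- `hRS` from unitarity and the trace letters; the level memberships from the tower datum
  have hRS : ∀ (b : Bond d (towerP L m (n + 1))) (v u : W), ⟪adTransportW φ U b v, u⟫_ℂ = ⟪v, adTransportW φ (fun b => (U b)⁻¹) b u⟫_ℂ :=
    adTransportW_adjoint φ τ hτ₂ hUst hφτ
  have hLb := hLb_of_hU1 L m n U hU1
  -- the `R`-letter BY NAME
  have hR : ∀ s : SiteL2K ℂ d (towerP L m (n + 1)) c₀ W,
      ‖RofUk L m n φ η U s - RofUk L m n φ η (fun _ : Bond d (towerP L m (n + 1)) => (1 : 𝔸ˣ)) s‖ ≤ CR * α * ‖s‖ :=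
    HR n η hηL c₀ c₁ hw m U εU hεU hUε hLb hα0 hαR' hRS hUb hUη hεg
  exact H n η hηL hL3 c₀ c₁ hw hρ m U αU hα1 hU1 hreg εU hεU hUε hα0 hα₁' hUst hUb hUη hpl hεg hR hposU hpos1 hQU hQ1 b

end Literature.MathematicalPhysics.QuantumFieldTheory.Balaban1983to89.B9Eq3126H1kLipschitzEnergyLetterfree

end
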